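import Summits.AtomisticToContinuum.Crystallization.Theorems.FrustratedLawDichotomyCellT2flatClassesA
import Summits.AtomisticToContinuum.Crystallization.Theorems.FrustratedLawDichotomyCellT2flatClassesB
import Summits.AtomisticToContinuum.Crystallization.Theorems.FrustratedLawDichotomyCellT2flatClassesC
import Summits.AtomisticToContinuum.Crystallization.Theorems.FrustratedLawDichotomyCellT2flatClassesD

/-!
# FrustratedLawDichotomy · crux `AperiodicFrustratedLawGap` (stmt-AtomisticToContinuum-27623) — ★★ THE T′♭₄₅ LITERAL OF RECORD IS FALSE:
# second, deeper witness: `¬ SchurTopologicalPricing (1/20) (1/8) w₄₅ ω₄ (3/400) (−7175/10000) κ_T C_T` for every `κ_T ≥ 0.923·10⁻²` and every `C_T`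
# (decomp-a2c, prover hand 1, generation 15; critic rows 543 (B3)(2) / 555 (B) / 564 (i); axioms standard — sixteen `decide +kernel` class evaluations)

THE WITNESS (`…CellT2flatData.cellT`): an all-strained hcp 2×2×2 periodic cell found this generation by optimising the CERTIFIABLE flag directly — every site
has radial spread `r₁₂/d = 1.1254 ≥ 9/8` (so, by the rotation-free radial obstruction `…CellKitF.not_goodAt_of_radial`, it is NOT `1/8`-good and NOT
`1/20`-good for ANY isometry and ANY assignment), a clean twelve-shell, separation `≥ 0.93`, and mean priced `W₄₅` site energy `−0.7175 + 0.92264·10⁻²`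
(certified upper bound from `…CellKitW.effPot_le_ubW` termwise; num/certify-style exact mirror).  Hand-1 g14's T-ceiling was `1.3128·10⁻²` (misfit-based
adversary); the `E₂g` optical basal-slip basin found here is cheaper by `3.2·10⁻³` per site and crosses the literal `κ_T = 1/100`.
THE THEOREMS: `cellT2_checkClass`, ★ `not_schurTopologicalPricing_fourHalf_of_ge` (`923/10⁵ ≤ κ_T`, every `C_T`; the literal `1/100` is `…CellTflatCeiling`) — through `…CellCheckerBad.not_schurTopologicalPricing_fourHalf_of_checkBad` and the all-bad twin
`…PeriodicBlockViolationBad.not_schurTopologicalPricing_of_badCell` of hand-2 g15's periodic-block negative kernel.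
CONSEQUENCE for the column of record: every door taking `hT : SchurTopologicalPricing (1/20) (1/8) w₄₅ ω₄ (3/400) (−7175/10000) (1/100) C_T`
(`…SchurCutB.fdg_of_split_schurCut_fourHalf'`-type kernels, `…PeriodicEnergyCeiling`, `…SchurMotifFourHalfProved`, `…OptimalityCut`, `…AveragingCut*`)
has an UNSATISFIABLE hypothesis at that literal; the T-price must be re-filed below `0.923·10⁻²` (and the true infimum over periodic all-bad cells may be lower
still — this is ONE basin of a 16-atom cell).  All `[folklore]`; 0 sorry; no `native_decide`.
-/

namespace Summit.AtomisticToContinuum.Crystallization.Theorems.FrustratedLawDichotomyCellT2flatCeiling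

open Summit.AtomisticToContinuum.Crystallization.Theorems.FrustratedLawDichotomySchurCut
open Summit.AtomisticToContinuum.Crystallization.Theorems.FrustratedLawDichotomyCellChecker

/-- All sixteen classes of `cellT2` pass `checkClassBad`. [folklore] -/
theorem cellT2_checkClass : ∀ m : Fin cellT2.N₀, cellT2.checkClassBad m (cellT2Cert m) = true := by
  intro m
  obtain ⟨m, hm⟩ := m
  have hm' : m < 16 := hm
  interval_cases m
  exacts [cellT2_checkClass0, cellT2_checkClass1, cellT2_checkClass2, cellT2_checkClass3, cellT2_checkClass4, cellT2_checkClass5, cellT2_checkClass6, cellT2_checkClass7, cellT2_checkClass8, cellT2_checkClass9, cellT2_checkClass10, cellT2_checkClass11, cellT2_checkClass12, cellT2_checkClass13, cellT2_checkClass14, cellT2_checkClass15]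

/-- ★ **T′♭₄₅ ceiling**: for every `κ_T ≥ 923/10⁵` and every `C_T`, `¬ SchurTopologicalPricing (1/20) (1/8) w₄₅ ω₄ (3/400) (−7175/10000) κ_T C_T`. [folklore] -/
theorem not_schurTopologicalPricing_fourHalf_of_ge {κT : ℝ} (hκ : (923 : ℝ) / 10 ^ 5 ≤ κT) (CT : ℝ) :
    ¬ SchurTopologicalPricing (1 / 20) (1 / 8) w₄₅ ω₄ (3 / 400) (-(7175 / 10000)) κT CT := by
  refine cellT2.not_schurTopologicalPricing_fourHalf_of_checkBad cellT2Cert cellT2_checkGeom cellT2_checkClass ?_ CT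
  have hN : ((cellT2.N₀ : ℕ) : ℝ) = 16 := by norm_num [cellT2]
  rw [hN]
  calc _ < (((16 * (-(7175 / 10000) + 923 / 10 ^ 5) : ℚ)) : ℝ) := (Rat.cast_lt (K := ℝ)).2 cellT2_total
    _ ≤ 16 * (-(7175 / 10000) + _) := by push_cast; nlinarith

end Summit.AtomisticToContinuum.Crystallization.Theorems.FrustratedLawDichotomyCellT2flatCeiling
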